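import Literature.NumberTheory.Rogawski1990.AdelicStableOrbitalEulerDischargeH
import HarnessLib

/-!
# `Φ^{st,𝐀}_H(γ_H, f^H) = 0` for an `H`-class with NO archimedean match in the inner form (Rogawski 1990, §14.3 pp. 233–234; §14.5 Lemma 14.5.2 (a) p. 238)

Topic `NumberTheory/Rogawski1990`; namespace `Literature.NumberTheory.Rogawski1990`; **THEOREMS ONLY** (no definition, no named fact, no instance, no
notation, no `sorry`).  Cell `pub/hodgecm-mathlib`, ENGINE T1 (crux H413 = `stmt-HodgeConjecture-24833`), row «T1b-VANISH» (F0P3a-p01 (g5); the third part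
of the trichotomy `EllipticStabilisation ⇐ T1b-reg ∧ T1b-nonreg ∧ T1b-vanish`): on Δ-transfers `f′ ↦ f^H` from the inner form `G′ = U(H′)`, the `H`-side term
`SJ_H(𝒪H, f^H) = κ_H · Φ^{st,𝐀}_H(γ_H; m^H; f^H)` VANISHES at every `G`-regular class `𝒪H = 𝒪′_st(γ_H)` whose archimedean component `γ_H ⊗ 1` matches NO
element of `G′_∞ = U(H′)(L⁺ ⊗ ℝ)` — the in-tree half of print's «`SJ(𝒪′_st, f′^H) = 0` unless `𝒪′_st` transfers to a class occurring in `G′`» (the other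
half, «no global transfer ⇒ no archimedean match», is the occurrence local–global principle, a separate row).  HC_CM is proved only modulo the printed
citations until rung 0 closes.

Mechanism ([Rogawski1990] §14.3: `Φ^st_H(γ_H, f′^H_∞) = Σ_{γ′ ↔ γ_H} Δ′_∞(γ_H, γ′) Φ(γ′, f′_∞)`, an EMPTY sum when nothing matches): ★ `IsArchDeltaTransfer` is
★ `IsDeltaTransferRel` at `∞`, whose transfer factor ★ `TransferFactorData` VANISHES off the matching pairs (`eq_zero_of_not_rel`); so the archimedean stable
orbital integral of `f^H_∞` at `γ_H ⊗ 1` is `0` (§1), and the Euler form ★ E3c-H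
`MatchingAdeleH.exists_isEulerOnClasses_ofLocalAdelicPair_of_isCanonical'` («`Σ_{δ ∈ 𝒞′_𝐀(γ_H)} Φ(δ, f^H) = Φ^st_{H,∞} · ∏_{v ∈ S} Φ^st_{H,v}`») makes the
adelic stable orbital integral vanish (§2–§3).

* §1 **`IsArchDeltaTransfer.stableOrbitalIntegralRel_eq_zero_of_forall_not_isArchNormPair`** — no archimedean match ⇒ `Φ^st_{H,∞}(γ_H, f^H_∞) = 0`.
* §2 **`adelicStableOrbitalSum_eq_zero_of_isEulerOnClasses_of_eq_zero`** — an Euler form with a vanishing archimedean factor has sum `0`.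
* §3 **`adelicStableOrbitalIntegralH_eq_zero_of_forall_not_isArchNormPair`** — ★ E3c-H's binders VERBATIM + an archimedean Δ-transfer + no match ⇒
  `Φ^{st,𝐀}_H(γ_H; ofLocalAdelicPair m^H m^H_∞; T^H.eval) = 0`.

## References
* [Rogawski1990] J. D. Rogawski, *Automorphic Representations of Unitary Groups in Three Variables*, Ann. of Math. Stud. 123 (1990), §4.3 (4.3.1) p. 43,
  §14.3 pp. 233–234, §14.5 Thm. 14.5.1 (a), Lemma 14.5.2 (a) p. 238.
* [Kottwitz1986] R. E. Kottwitz, *Stable trace formula: elliptic singular terms*, Math. Ann. 275 (1986), Prop. 7.1.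
-/

set_option autoImplicit false

noncomputable section

open NumberField IsDedekindDomain Filter Function MeasureTheory
open scoped MatrixGroups

namespace Literature.NumberTheory.Rogawski1990

open Literature.NumberTheory.Automorphic Literature.NumberTheory.Automorphic.UnitaryGroup Literature.MeasureTheory.Group
open Literature.AlgebraicGeometry.ShimuraVarieties (unitaryGroup)

/-! ## §1 No archimedean match ⇒ the archimedean stable orbital integral of a Δ-transfer vanishes -/

section Arch

variable {L : Type} [Field L] [NumberField L] [IsCMField L] {H' : Matrix (Fin 3) (Fin 3) L}
  [∀ a : pairArch L (Matrix.of fun i j : Fin 2 => if i.val + j.val + 1 = 2 then (1 : L) else 0) (Matrix.of fun i j : Fin 1 => if i.val + j.val + 1 = 1 then (1 : L) else 0),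
    MeasurableSpace (pairArch L (Matrix.of fun i j : Fin 2 => if i.val + j.val + 1 = 2 then (1 : L) else 0) (Matrix.of fun i j : Fin 1 => if i.val + j.val + 1 = 1 then (1 : L) else 0) ⧸
      Subgroup.centralizer ({a} : Set (pairArch L (Matrix.of fun i j : Fin 2 => if i.val + j.val + 1 = 2 then (1 : L) else 0) (Matrix.of fun i j : Fin 1 => if i.val + j.val + 1 = 1 then (1 : L) else 0))))]
  [∀ γ : UnitaryGroup.arch (↥(maximalRealSubfield L)) L (IsCMField.complexConj L) 3 H',
    MeasurableSpace (UnitaryGroup.arch (↥(maximalRealSubfield L)) L (IsCMField.complexConj L) 3 H' ⧸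
      Subgroup.centralizer ({γ} : Set (UnitaryGroup.arch (↥(maximalRealSubfield L)) L (IsCMField.complexConj L) 3 H')))]

/-- **No archimedean match ⇒ `Φ^st_{H,∞}(γ_H, f^H_∞) = 0`.**  If `f′_∞ ↦ f^H_∞` is an archimedean Δ-transfer (★ `IsArchDeltaTransfer`) and the `G`-regular
`γ_H ∈ H_∞` matches NO `γ′ ∈ G′_∞ = U(H′)(L⁺ ⊗ ℝ)` (`¬ IsArchNormPair`), then the stable orbital integral of `f^H_∞` at `γ_H` vanishes: §14.3's sum
`Σ_{[γ′]} Δ′_∞(γ_H, γ′) Φ([γ′], f′_∞)` has every transfer factor zero (★ `TransferFactorData.eq_zero_of_not_rel`).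
[cite: Rogawski1990, §14.3 pp. 233–234; §4.3 (4.3.1) p. 43] -/
theorem IsArchDeltaTransfer.stableOrbitalIntegralRel_eq_zero_of_forall_not_isArchNormPair {T : ArchTransferFactor L H'}
    {mH : OrbitalMeasureFamily (pairArch L (Matrix.of fun i j : Fin 2 => if i.val + j.val + 1 = 2 then (1 : L) else 0) (Matrix.of fun i j : Fin 1 => if i.val + j.val + 1 = 1 then (1 : L) else 0))}
    {mG : OrbitalMeasureFamily (UnitaryGroup.arch (↥(maximalRealSubfield L)) L (IsCMField.complexConj L) 3 H')}
    {aH : pairArch L (Matrix.of fun i j : Fin 2 => if i.val + j.val + 1 = 2 then (1 : L) else 0) (Matrix.of fun i j : Fin 1 => if i.val + j.val + 1 = 1 then (1 : L) else 0) → ℂ}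
    {a : UnitaryGroup.arch (↥(maximalRealSubfield L)) L (IsCMField.complexConj L) 3 H' → ℂ}
    (h : IsArchDeltaTransfer L H' T mH mG aH a)
    {γH : pairArch L (Matrix.of fun i j : Fin 2 => if i.val + j.val + 1 = 2 then (1 : L) else 0) (Matrix.of fun i j : Fin 1 => if i.val + j.val + 1 = 1 then (1 : L) else 0)}
    (hreg : IsArchGRegular L γH)
    (hno : ∀ γ : UnitaryGroup.arch (↥(maximalRealSubfield L)) L (IsCMField.complexConj L) 3 H', ¬ IsArchNormPair L H' γH γ) :
    stableOrbitalIntegralRel (IsArchStablyConjH L) mH aH γH = 0 := by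
  rw [(isArchDeltaTransfer_iff L H' T mH mG aH a).mp h γH hreg]
  refine finsum_eq_zero_of_forall_eq_zero fun c => ?_
  rw [T.eq_zero_of_not_rel γH (Quotient.out c) (hno _), zero_mul]

end Arch

/-! ## §2 An Euler form with a vanishing factor -/

section Euler

variable {Γ : Type*} [Group Γ] [∀ g : Γ, MeasurableSpace (Γ ⧸ Subgroup.centralizer ({g} : Set Γ))]
  (𝒞 : Set (ConjClasses Γ)) (m : OrbitalMeasureFamily Γ)

/-- If `Σ_{δ ∈ 𝒞} Φ(δ, f) = arch · ∏_{v ∈ S} loc_v` (★ `IsEulerOnClasses`) and `arch = 0`, the sum vanishes. [cite: Rogawski1990, §4.3 p. 44] -/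
theorem adelicStableOrbitalSum_eq_zero_of_isEulerOnClasses_of_eq_zero {ι : Type*} {f : Γ → ℂ} {S : Finset ι} {loc : ι → ℂ} {arch : ℂ}
    (h : IsEulerOnClasses 𝒞 m f S loc arch) (harch : arch = 0) : adelicStableOrbitalSum 𝒞 m f = 0 := by
  rw [(isEulerOnClasses_iff 𝒞 m f S loc arch).mp h, harch, zero_mul]

end Euler

/-! ## §3 `Φ^{st,𝐀}_H(γ_H; ofLocalAdelicPair m^H m^H_∞; T^H.eval) = 0` when `γ_H ⊗ 1` has no archimedean match -/

section Adelic

variable {L : Type} [Field L] [NumberField L] [IsCMField L] {H' : Matrix (Fin 3) (Fin 3) L}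
variable {γH : (UnitaryGroup.cmDatum L 2 (Matrix.of fun i j : Fin 2 => if i.val + j.val + 1 = 2 then (1 : L) else 0)).Rational ×
  (UnitaryGroup.cmDatum L 1 (Matrix.of fun i j : Fin 1 => if i.val + j.val + 1 = 1 then (1 : L) else 0)).Rational}
variable
  [∀ h : pairAdelic L (Matrix.of fun i j : Fin 2 => if i.val + j.val + 1 = 2 then (1 : L) else 0) (Matrix.of fun i j : Fin 1 => if i.val + j.val + 1 = 1 then (1 : L) else 0),
    MeasurableSpace (pairAdelic L (Matrix.of fun i j : Fin 2 => if i.val + j.val + 1 = 2 then (1 : L) else 0) (Matrix.of fun i j : Fin 1 => if i.val + j.val + 1 = 1 then (1 : L) else 0) ⧸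
      Subgroup.centralizer ({h} : Set (pairAdelic L (Matrix.of fun i j : Fin 2 => if i.val + j.val + 1 = 2 then (1 : L) else 0) (Matrix.of fun i j : Fin 1 => if i.val + j.val + 1 = 1 then (1 : L) else 0))))]
  [∀ h : pairAdelic L (Matrix.of fun i j : Fin 2 => if i.val + j.val + 1 = 2 then (1 : L) else 0) (Matrix.of fun i j : Fin 1 => if i.val + j.val + 1 = 1 then (1 : L) else 0),
    BorelSpace (pairAdelic L (Matrix.of fun i j : Fin 2 => if i.val + j.val + 1 = 2 then (1 : L) else 0) (Matrix.of fun i j : Fin 1 => if i.val + j.val + 1 = 1 then (1 : L) else 0) ⧸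
      Subgroup.centralizer ({h} : Set (pairAdelic L (Matrix.of fun i j : Fin 2 => if i.val + j.val + 1 = 2 then (1 : L) else 0) (Matrix.of fun i j : Fin 1 => if i.val + j.val + 1 = 1 then (1 : L) else 0))))]
  [∀ a : pairArch L (Matrix.of fun i j : Fin 2 => if i.val + j.val + 1 = 2 then (1 : L) else 0) (Matrix.of fun i j : Fin 1 => if i.val + j.val + 1 = 1 then (1 : L) else 0),
    MeasurableSpace (pairArch L (Matrix.of fun i j : Fin 2 => if i.val + j.val + 1 = 2 then (1 : L) else 0) (Matrix.of fun i j : Fin 1 => if i.val + j.val + 1 = 1 then (1 : L) else 0) ⧸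
      Subgroup.centralizer ({a} : Set (pairArch L (Matrix.of fun i j : Fin 2 => if i.val + j.val + 1 = 2 then (1 : L) else 0) (Matrix.of fun i j : Fin 1 => if i.val + j.val + 1 = 1 then (1 : L) else 0))))]
  [∀ a : pairArch L (Matrix.of fun i j : Fin 2 => if i.val + j.val + 1 = 2 then (1 : L) else 0) (Matrix.of fun i j : Fin 1 => if i.val + j.val + 1 = 1 then (1 : L) else 0),
    BorelSpace (pairArch L (Matrix.of fun i j : Fin 2 => if i.val + j.val + 1 = 2 then (1 : L) else 0) (Matrix.of fun i j : Fin 1 => if i.val + j.val + 1 = 1 then (1 : L) else 0) ⧸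
      Subgroup.centralizer ({a} : Set (pairArch L (Matrix.of fun i j : Fin 2 => if i.val + j.val + 1 = 2 then (1 : L) else 0) (Matrix.of fun i j : Fin 1 => if i.val + j.val + 1 = 1 then (1 : L) else 0))))]
  [∀ (v : HeightOneSpectrum (𝓞 ↥(maximalRealSubfield L)))
      (x : pairLocal L (Matrix.of fun i j : Fin 2 => if i.val + j.val + 1 = 2 then (1 : L) else 0) (Matrix.of fun i j : Fin 1 => if i.val + j.val + 1 = 1 then (1 : L) else 0) v),
    MeasurableSpace (pairLocal L (Matrix.of fun i j : Fin 2 => if i.val + j.val + 1 = 2 then (1 : L) else 0) (Matrix.of fun i j : Fin 1 => if i.val + j.val + 1 = 1 then (1 : L) else 0) v ⧸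
      Subgroup.centralizer ({x} : Set (pairLocal L (Matrix.of fun i j : Fin 2 => if i.val + j.val + 1 = 2 then (1 : L) else 0) (Matrix.of fun i j : Fin 1 => if i.val + j.val + 1 = 1 then (1 : L) else 0) v)))]
  [∀ (v : HeightOneSpectrum (𝓞 ↥(maximalRealSubfield L)))
      (x : pairLocal L (Matrix.of fun i j : Fin 2 => if i.val + j.val + 1 = 2 then (1 : L) else 0) (Matrix.of fun i j : Fin 1 => if i.val + j.val + 1 = 1 then (1 : L) else 0) v),
    BorelSpace (pairLocal L (Matrix.of fun i j : Fin 2 => if i.val + j.val + 1 = 2 then (1 : L) else 0) (Matrix.of fun i j : Fin 1 => if i.val + j.val + 1 = 1 then (1 : L) else 0) v ⧸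
      Subgroup.centralizer ({x} : Set (pairLocal L (Matrix.of fun i j : Fin 2 => if i.val + j.val + 1 = 2 then (1 : L) else 0) (Matrix.of fun i j : Fin 1 => if i.val + j.val + 1 = 1 then (1 : L) else 0) v)))]
  [∀ γ : UnitaryGroup.arch (↥(maximalRealSubfield L)) L (IsCMField.complexConj L) 3 H',
    MeasurableSpace (UnitaryGroup.arch (↥(maximalRealSubfield L)) L (IsCMField.complexConj L) 3 H' ⧸
      Subgroup.centralizer ({γ} : Set (UnitaryGroup.arch (↥(maximalRealSubfield L)) L (IsCMField.complexConj L) 3 H')))]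
  [∀ v : HeightOneSpectrum (𝓞 ↥(maximalRealSubfield L)), MeasurableSpace (pairLocal L (Matrix.of fun i j : Fin 2 => if i.val + j.val + 1 = 2 then (1 : L) else 0) (Matrix.of fun i j : Fin 1 => if i.val + j.val + 1 = 1 then (1 : L) else 0) v)]
  [∀ v : HeightOneSpectrum (𝓞 ↥(maximalRealSubfield L)), BorelSpace (pairLocal L (Matrix.of fun i j : Fin 2 => if i.val + j.val + 1 = 2 then (1 : L) else 0) (Matrix.of fun i j : Fin 1 => if i.val + j.val + 1 = 1 then (1 : L) else 0) v)]

/-- **`Φ^{st,𝐀}_H(γ_H; ofLocalAdelicPair m^H m^H_∞; T^H.eval) = 0` WHEN `γ_H ⊗ 1` MATCHES NOTHING IN `G′_∞`.**  ★ E3c-H's binders VERBATIM (`H = U(Φ₂) × U(Φ₁)`,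
`γ_H` rational `G`-regular, `νH_v` Haar with `νH_v(K_{2,v} × K_{1,v}) = 1`, `m^H_v` admissible and canonical on the `G`-regular classes, `m^H_∞` admissible, `T^H` an
unramified pure tensor pair with continuous compactly supported bad ∕ archimedean factors) PLUS an archimedean Δ-transfer `f′_∞ ↦ T^H.arch` for the inner form
`G′ = U(H′)` (`harch`, any factor `Tinf`, any `G′_∞`-family `mGi`, any `f′_∞ = a`) and `hno`: NO `γ′ ∈ U(H′)(L⁺ ⊗ ℝ)` with `γ_H ⊗ 1 ↔ γ′`.  Then the adelic stable
orbital integral `Σ_{δ ∈ 𝒞′_𝐀(γ_H)} Φ(δ, T^H.eval)` against ★ C3-H `ofLocalAdelicPair m^H m^H_∞` vanishes — its Euler form (★ E3c-H) has the archimedean factor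
`Φ^st_{H,∞}(γ_H ⊗ 1, T^H.arch) = 0` (§1).  This is the analytic half of [Lemma 14.5.2 (a)] ∕ of «`SJ(𝒪′_st, f′^H) = 0` unless `𝒪′_st` transfers to a class
occurring in `G′`»; the arithmetic half (no global transfer ⇒ no archimedean match) is the occurrence local–global principle.
[cite: Rogawski1990, §14.3 pp. 233–234; §14.5 Thm. 14.5.1 (a), Lemma 14.5.2 (a) p. 238; §4.3 p. 44] [cite: Kottwitz1986, Prop. 7.1] -/
theorem adelicStableOrbitalIntegralH_eq_zero_of_forall_not_isArchNormPair
    (νH : ∀ v : HeightOneSpectrum (𝓞 ↥(maximalRealSubfield L)), Measure (pairLocal L (Matrix.of fun i j : Fin 2 => if i.val + j.val + 1 = 2 then (1 : L) else 0) (Matrix.of fun i j : Fin 1 => if i.val + j.val + 1 = 1 then (1 : L) else 0) v))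
    [∀ v, (νH v).IsHaarMeasure] [∀ v, (νH v).IsMulRightInvariant]
    (hν : ∀ v, νH v ((cmLocalIntegralLevel L 2 (Matrix.of fun i j : Fin 2 => if i.val + j.val + 1 = 2 then (1 : L) else 0) v : Set ((UnitaryGroup.cmDatum L 2 (Matrix.of fun i j : Fin 2 => if i.val + j.val + 1 = 2 then (1 : L) else 0)).Local v)) ×ˢ
      (cmLocalIntegralLevel L 1 (Matrix.of fun i j : Fin 1 => if i.val + j.val + 1 = 1 then (1 : L) else 0) v : Set ((UnitaryGroup.cmDatum L 1 (Matrix.of fun i j : Fin 1 => if i.val + j.val + 1 = 1 then (1 : L) else 0)).Local v))) = 1)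
    (hreg : IsGRegular (cmConjRingHom L) (Matrix.of fun i j : Fin 2 => if i.val + j.val + 1 = 2 then (1 : L) else 0)
      (Matrix.of fun i j : Fin 1 => if i.val + j.val + 1 = 1 then (1 : L) else 0) (Matrix.of fun i j : Fin 3 => if i.val + j.val + 1 = 3 then (1 : L) else 0)
      endoForm_antidiagOne γH)
    (mH : ∀ v : HeightOneSpectrum (𝓞 ↥(maximalRealSubfield L)),
      OrbitalMeasureFamily (pairLocal L (Matrix.of fun i j : Fin 2 => if i.val + j.val + 1 = 2 then (1 : L) else 0) (Matrix.of fun i j : Fin 1 => if i.val + j.val + 1 = 1 then (1 : L) else 0) v))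
    (mHi : OrbitalMeasureFamily (pairArch L (Matrix.of fun i j : Fin 2 => if i.val + j.val + 1 = 2 then (1 : L) else 0) (Matrix.of fun i j : Fin 1 => if i.val + j.val + 1 = 1 then (1 : L) else 0)))
    (hadm : ∀ v, (mH v).IsAdmissibleOn (IsLocalGRegular L v)) (hcan : ∀ v, (mH v).IsCanonical (IsLocalGRegular L v) (νH v))
    (hadmA : mHi.IsAdmissibleOn (IsArchGRegular L))
    (TH : PureTensor₂ L (Matrix.of fun i j : Fin 2 => if i.val + j.val + 1 = 2 then (1 : L) else 0) (Matrix.of fun i j : Fin 1 => if i.val + j.val + 1 = 1 then (1 : L) else 0))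
    (hTH : TH.IsUnramified₂) (hTc : ∀ v ∈ TH.S, HasCompactSupport (TH.loc v)) (hTa : HasCompactSupport TH.arch)
    (hTc' : ∀ v ∈ TH.S, Continuous (TH.loc v)) (hTa' : Continuous TH.arch)
    -- the archimedean Δ-transfer from the inner form `G′ = U(H′)` and the absence of an archimedean match
    {Tinf : ArchTransferFactor L H'} {mGi : OrbitalMeasureFamily (UnitaryGroup.arch (↥(maximalRealSubfield L)) L (IsCMField.complexConj L) 3 H')}
    {a : UnitaryGroup.arch (↥(maximalRealSubfield L)) L (IsCMField.complexConj L) 3 H' → ℂ}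
    (harch : IsArchDeltaTransfer L H' Tinf mHi mGi TH.arch a)
    (hno : ∀ γ : UnitaryGroup.arch (↥(maximalRealSubfield L)) L (IsCMField.complexConj L) 3 H', ¬ IsArchNormPair L H' (rationalArch L γH) γ) :
    adelicStableOrbitalIntegralH L γH
      (OrbitalMeasureFamily.ofLocalAdelicPair L (Matrix.of fun i j : Fin 2 => if i.val + j.val + 1 = 2 then (1 : L) else 0) (Matrix.of fun i j : Fin 1 => if i.val + j.val + 1 = 1 then (1 : L) else 0) mH mHi)
      TH.eval = 0 := by
  obtain ⟨S₁, hS₁⟩ := MatchingAdeleH.exists_isEulerOnClasses_ofLocalAdelicPair_of_isCanonical' νH hν hreg mH mHi hadm hcan hadmA TH hTH hTc hTa hTc' hTa'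
  rw [adelicStableOrbitalIntegralH_def]
  exact adelicStableOrbitalSum_eq_zero_of_isEulerOnClasses_of_eq_zero _ _ (hS₁ S₁ subset_rfl)
    (harch.stableOrbitalIntegralRel_eq_zero_of_forall_not_isArchNormPair (isArchGRegular_cmRationalToArch_of_isGRegular L γH hreg) hno)

end Adelic

end Literature.NumberTheory.Rogawski1990

end
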